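import Mathlib
import HarnessLib
import Summits.NavierStokesRegularity.NavierStokesRegularity.Theorems.TaylorModelRungThreeCertificateCoreStepDefs

/-!
# Crux K1b-DR (stmt-NavierStokesRegularity-23954), line `taylor-model` — the sub-step core, part 3: SOUNDNESS of `coreStep` for the
# conjuncts (E) [high-order disjunct], (J) and (M) of `ChainVCore` (`…TaylorModelRungThreeVDefs`, verbatim shapes)

With `out := T.coreStep ci`, `out.ok = true`, `ci.mt = T.monosTable ci.coefB`, `CoefOK`/`CoefBoxOK` and `ci.H2.size = T.n`, and writing
`lo := T.vecF (vre out.lo)`, … (engine-1's window functions of the dyadic output arrays), `Hlo/Hhi := T.vecF (loR/hiR ci.H2)`: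
* `coreStep_E2` — for every `z` in the hull box, `u ∈ [0, h]` and window `(i,k)`:
  `lo i k < Σ_{m≤p} taylorJet d.Qb z m i k · u^m − J i k · u^(p+1)` and `… + J i k · u^(p+1) < hi i k` (STRICT);
* `coreStep_J` — for every `y` in the tube box `[lo+loK, hi+hiK]`: `|taylorJet d.Qb y (p+1) i k| ≤ J i k`;
* `coreStep_M` — for every `z` in the hull box and all window pairs: `(imget out.M (idx i' k') (idx i k)).lo ≤ Σ_{m≤pV} varJet d.Qb z (basisSt i k) m i' k'
  · h^m − JU i' k' · (ω k)⁻¹ · h^(pV+1)` and the symmetric upper bound, for any `ω` with `(ω k)⁻¹ ∈ ci.ωinvB[idx i k]`.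
Helpers: the coordinate memberships `mem_B/mem_TB/mem_TB2/mem_BK/mem_BV_of_inBoxW` of states in the output boxes.

MODEL-lattice bookkeeping only (rung TL-M3); nothing here concerns the Navier–Stokes equations.
-/

-- the sub-problem namespace repeats the summit name by design (D-0017)
set_option linter.dupNamespace false

namespace Summit.NavierStokesRegularity.NavierStokesRegularity.Theorems.TaylorModelCert

open scoped BigOperators
open Set
open Literature.Analysis.FluidPDE.TaoCascade Literature.Analysis.FluidPDE.TaoCascade.TaylorChain
open Summit.NavierStokesRegularity.NavierStokesRegularity.Theorems.TaylorModelReadout (taylorJet taylorJet_zero varJet)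
open Summit.NavierStokesRegularity.NavierStokesRegularity.Theorems.TaylorModelV (basisSt)

namespace CertTables

variable {K : Type} [Field K] {φ : K →+* ℝ} (T : CertTables K) (ci : CoreIn)

/-! ### The components of `ok` -/

omit [Field K] in
/-- [folklore] -/
theorem coreStep_okE (hok : (T.coreStep ci).ok = true) :
    IntervalD.testE2 T.n ci.prec (ci.B T) (ci.P T) (ci.Jarr T) ci.Hp = true := by
  rw [CoreIn.coreStep_ok] at hok; simp only [Bool.and_eq_true] at hok; exact hok.1.1

omit [Field K] in
/-- [folklore] -/
theorem coreStep_okK (hok : (T.coreStep ci).ok = true) :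
    IntervalD.testK T.n ci.prec ci.L1 ci.h ci.κωB (ci.hK T) (ci.G T) = true := by
  rw [CoreIn.coreStep_ok] at hok; simp only [Bool.and_eq_true] at hok; exact hok.1.2

omit [Field K] in
/-- [folklore] -/
theorem coreStep_okV (hok : (T.coreStep ci).ok = true) :
    IntervalD.testK T.n ci.prec ci.L1 ci.h ci.ωB (ci.hV T) (ci.G' T) = true := by
  rw [CoreIn.coreStep_ok] at hok; simp only [Bool.and_eq_true] at hok; exact hok.2

/-! ### Reading the output arrays -/

omit [Field K] in
/-- [folklore] -/
theorem vecF_vre (v : Array Dyad) (i : Fin 4) {k : ℤ} (hk : -T.Kb ≤ k ∧ k ≤ T.Ka) :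
    T.vecF (vre v) i k = (dget v (T.idx i k)).toReal := by
  rw [T.vecF_apply, if_pos hk]; rfl

omit [Field K] in
/-- [folklore] -/
theorem out_lo (c : ℕ) (hc : c < T.n) : dget (T.coreStep ci).lo c = (IntervalD.aget (ci.B T) c).lo := by
  rw [CoreIn.coreStep_lo, dget_ofFn _ hc]

omit [Field K] in
/-- [folklore] -/
theorem out_hi (c : ℕ) (hc : c < T.n) : dget (T.coreStep ci).hi c = (IntervalD.aget (ci.B T) c).hi := by
  rw [CoreIn.coreStep_hi, dget_ofFn _ hc]

omit [Field K] in
/-- [folklore] -/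
theorem out_loK (c : ℕ) (hc : c < T.n) : (dget (T.coreStep ci).loK c).toReal = -(dget (ci.hK T) c).toReal := by
  rw [CoreIn.coreStep_loK, dget_ofFn _ hc, Dyad.toReal_neg]

omit [Field K] in
/-- [folklore] -/
theorem out_loV (c : ℕ) (hc : c < T.n) : (dget (T.coreStep ci).loV c).toReal = -(dget (ci.hV T) c).toReal := by
  rw [CoreIn.coreStep_loV, dget_ofFn _ hc, Dyad.toReal_neg]

omit [Field K] in
/-- Tube box coordinate: `(TB c).lo = B.lo − hK`, `(TB c).hi = B.hi + hK`. [folklore] -/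
theorem aget_TB (c : ℕ) (hc : c < T.n) : IntervalD.aget (ci.TB T) c =
    IntervalD.add (IntervalD.aget (ci.B T) c) (IntervalD.symBox (dget (ci.hK T) c)) := by
  unfold CoreIn.TB; rw [IntervalD.aget_ofFn _ hc]; unfold CoreIn.BK; rw [IntervalD.aget_ofFn _ hc]

omit [Field K] in
/-- [folklore] -/
theorem aget_TB2 (c : ℕ) (hc : c < T.n) : IntervalD.aget (ci.TB2 T) c =
    IntervalD.add (IntervalD.aget (ci.TB T) c) (IntervalD.symBox (dget (ci.hK T) c)) := by
  unfold CoreIn.TB2; rw [IntervalD.aget_ofFn _ hc]; unfold CoreIn.BK; rw [IntervalD.aget_ofFn _ hc]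

omit [Field K] in
/-- States of the box `[lo, hi]` lie coordinatewise in `B`. [folklore] -/
theorem mem_B_of_inBoxW {y : Fin 4 → ℤ → ℝ} (hy : T.InBoxW (T.vecF (vre (T.coreStep ci).lo)) (T.vecF (vre (T.coreStep ci).hi)) y) :
    ∀ c < T.n, IntervalD.mem (T.wv y c) (IntervalD.aget (ci.B T) c) :=
  T.mem_of_inBoxW_vecF (fun c hc => ⟨(T.out_lo ci c hc).symm, (T.out_hi ci c hc).symm⟩) hy

omit [Field K] in
/-- States of the tube box `[lo+loK, hi+hiK]` lie coordinatewise in `TB`. [folklore] -/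
theorem mem_TB_of_inBoxW {y : Fin 4 → ℤ → ℝ}
    (hy : T.InBoxW (T.vecF (vre (T.coreStep ci).lo) + T.vecF (vre (T.coreStep ci).loK))
      (T.vecF (vre (T.coreStep ci).hi) + T.vecF (vre (T.coreStep ci).hiK)) y) :
    ∀ c < T.n, IntervalD.mem (T.wv y c) (IntervalD.aget (ci.TB T) c) := by
  intro c hc
  have hk := T.InW_wk hc
  have h := hy (T.wi c) (T.wk c) hk.1 hk.2
  simp only [Pi.add_apply, T.vecF_vre _ _ hk, T.idx_wi_wk hc, T.out_loK ci c hc, CoreIn.coreStep_hiK] at h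
  rw [T.aget_TB ci c hc]
  simp only [IntervalD.mem, IntervalD.add, IntervalD.symBox, Dyad.toReal_add, Dyad.toReal_neg]
  rw [← T.out_lo ci c hc, ← T.out_hi ci c hc]
  exact ⟨by unfold wv; linarith [h.1], by unfold wv; linarith [h.2]⟩

omit [Field K] in
/-- States of the doubled tube box lie coordinatewise in `TB2`. [folklore] -/
theorem mem_TB2_of_inBoxW {y : Fin 4 → ℤ → ℝ}
    (hy : T.InBoxW (T.vecF (vre (T.coreStep ci).lo) + T.vecF (vre (T.coreStep ci).loK) + T.vecF (vre (T.coreStep ci).loK))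
      (T.vecF (vre (T.coreStep ci).hi) + T.vecF (vre (T.coreStep ci).hiK) + T.vecF (vre (T.coreStep ci).hiK)) y) :
    ∀ c < T.n, IntervalD.mem (T.wv y c) (IntervalD.aget (ci.TB2 T) c) := by
  intro c hc
  have hk := T.InW_wk hc
  have h := hy (T.wi c) (T.wk c) hk.1 hk.2
  simp only [Pi.add_apply, T.vecF_vre _ _ hk, T.idx_wi_wk hc, T.out_loK ci c hc, CoreIn.coreStep_hiK] at h
  rw [T.aget_TB2 ci c hc, T.aget_TB ci c hc]
  simp only [IntervalD.mem, IntervalD.add, IntervalD.symBox, Dyad.toReal_add, Dyad.toReal_neg]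
  rw [← T.out_lo ci c hc, ← T.out_hi ci c hc]
  exact ⟨by unfold wv; linarith [h.1], by unfold wv; linarith [h.2]⟩

omit [Field K] in
/-- States of the κ-difference box lie coordinatewise in `BK`. [folklore] -/
theorem mem_BK_of_inBoxW {y : Fin 4 → ℤ → ℝ} (hy : T.InBoxW (T.vecF (vre (T.coreStep ci).loK)) (T.vecF (vre (T.coreStep ci).hiK)) y) :
    ∀ c < T.n, IntervalD.mem (T.wv y c) (IntervalD.aget (ci.BK T) c) := by
  intro c hc
  have hk := T.InW_wk hc
  have h := hy (T.wi c) (T.wk c) hk.1 hk.2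
  simp only [T.vecF_vre _ _ hk, T.idx_wi_wk hc, T.out_loK ci c hc, CoreIn.coreStep_hiK] at h
  unfold CoreIn.BK; rw [IntervalD.aget_ofFn _ hc]
  simp only [IntervalD.mem, IntervalD.symBox, Dyad.toReal_neg]
  exact h

omit [Field K] in
/-- States of the variation box lie coordinatewise in `BV`. [folklore] -/
theorem mem_BV_of_inBoxW {y : Fin 4 → ℤ → ℝ} (hy : T.InBoxW (T.vecF (vre (T.coreStep ci).loV)) (T.vecF (vre (T.coreStep ci).hiV)) y) :
    ∀ c < T.n, IntervalD.mem (T.wv y c) (IntervalD.aget (ci.BV T) c) := by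
  intro c hc
  have hk := T.InW_wk hc
  have h := hy (T.wi c) (T.wk c) hk.1 hk.2
  simp only [T.vecF_vre _ _ hk, T.idx_wi_wk hc, T.out_loV ci c hc, CoreIn.coreStep_hiV] at h
  unfold CoreIn.BV; rw [IntervalD.aget_ofFn _ hc]
  simp only [IntervalD.mem, IntervalD.symBox, Dyad.toReal_neg]
  exact h

/-! ### The field twins of the attempt are enclosures -/

/-- [folklore] -/
theorem coreQBA_sound (hco : T.CoefOK φ) (hcB : CoefBoxOK φ T ci.coefB) (hmt : ci.mt = T.monosTable ci.coefB) :
    IntervalD.IsFieldEnclosureA T.wv (qBf (T.toCertData φ)) T.n (ci.QBA T) := by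
  unfold CoreIn.QBA; rw [hmt]; exact T.isFieldEnclosureA_qBboxMA hco hcB ci.prec

/-! ### (E) high-order disjunct, (J), (M) -/

/-- **(E), second disjunct** — the STRICT order-`p` rough-enclosure inequalities for every start of the hull box. [folklore] -/
theorem coreStep_E2 (hco : T.CoefOK φ) (hcB : CoefBoxOK φ T ci.coefB) (hmt : ci.mt = T.monosTable ci.coefB) (hH2 : ci.H2.size = T.n)
    (hok : (T.coreStep ci).ok = true) :
    ∀ z, T.InBoxW (T.vecF (IntervalD.loR ci.H2)) (T.vecF (IntervalD.hiR ci.H2)) z → ∀ u ∈ Icc 0 ci.h.toReal,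
      ∀ i k, -T.Kb ≤ k → k ≤ T.Ka →
        T.vecF (vre (T.coreStep ci).lo) i k <
            (∑ m ∈ Finset.range (ci.p + 1), taylorJet (T.toCertData φ).Qb z m i k * u ^ m) -
              T.vecF (vre (T.coreStep ci).J) i k * u ^ (ci.p + 1) ∧
          (∑ m ∈ Finset.range (ci.p + 1), taylorJet (T.toCertData φ).Qb z m i k * u ^ m) +
              T.vecF (vre (T.coreStep ci).J) i k * u ^ (ci.p + 1) < T.vecF (vre (T.coreStep ci).hi) i k := by
  intro z hz u hu i k hk1 hk2
  have hk : -T.Kb ≤ k ∧ k ≤ T.Ka := ⟨hk1, hk2⟩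
  have hc : T.idx i k < T.n := T.idx_lt_n i hk
  have hzc := T.mem_of_inBoxW_loR hz
  have hU : IntervalD.mem u ci.Uh := IntervalD.mem_zeroTo hu.1 hu.2
  have hpoly := IntervalD.mem_taylorPoly_of_jetLevelsA (rd := T.wv) (Q := qBf (T.toCertData φ)) (T := taylorJet (qBf (T.toCertData φ)))
    (fun x c _ => by rw [taylorJet_zero]) (fun x k c _ => T.wv_taylorJet_qBf_succ x k c) (T.coreQBA_sound ci hco hcB hmt) ci.prec ci.p
    hH2 hzc hU (T.idx i k) hc
  simp only [taylorJet_qBf, T.wv_idx _ i hk] at hpoly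
  have ht : IntervalD.mem (u ^ (ci.p + 1)) ci.Hp := IntervalD.mem_powR ci.prec hU (ci.p + 1)
  have hE := IntervalD.testE2_sound (T.coreStep_okE ci hok) hc hpoly ht
  rw [T.vecF_vre _ i hk, T.vecF_vre _ i hk, T.vecF_vre _ i hk, T.out_lo ci _ hc, T.out_hi ci _ hc, CoreIn.coreStep_J]
  unfold CoreIn.Jarr at hE ⊢
  exact hE

/-- **(J)** — the order-`p+1` jets over the tube box are bounded by `J`. [folklore] -/
theorem coreStep_J (hco : T.CoefOK φ) (hcB : CoefBoxOK φ T ci.coefB) (hmt : ci.mt = T.monosTable ci.coefB)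
    (hok : (T.coreStep ci).ok = true) :
    ∀ y, T.InBoxW (T.vecF (vre (T.coreStep ci).lo) + T.vecF (vre (T.coreStep ci).loK))
        (T.vecF (vre (T.coreStep ci).hi) + T.vecF (vre (T.coreStep ci).hiK)) y →
      ∀ i k, -T.Kb ≤ k → k ≤ T.Ka → |taylorJet (T.toCertData φ).Qb y (ci.p + 1) i k| ≤ T.vecF (vre (T.coreStep ci).J) i k := by
  intro y hy i k hk1 hk2
  have _ := hok
  have hk : -T.Kb ≤ k ∧ k ≤ T.Ka := ⟨hk1, hk2⟩
  have hc : T.idx i k < T.n := T.idx_lt_n i hk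
  have hyc := T.mem_TB_of_inBoxW ci hy
  have hj := T.mem_taylorJet_of_jetLevelsA_qBf (T.coreQBA_sound ci hco hcB hmt) ci.prec (ci.p + 1) (CoreIn.size_TB T ci) hyc (ci.p + 1)
    le_rfl (T.idx i k) hc
  rw [T.wv_idx _ i hk] at hj
  rw [T.vecF_vre _ i hk, CoreIn.coreStep_J]
  unfold CoreIn.Jarr
  rw [dget_ofFn _ hc]
  exact IntervalD.abs_le_mag hj

/-- **(M)** — the signed one-step derivative enclosure over the hull box (clause (M) verbatim). [folklore] -/
theorem coreStep_M (hco : T.CoefOK φ) (hcB : CoefBoxOK φ T ci.coefB) (hH2 : ci.H2.size = T.n) {ω : ℤ → ℝ}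
    (hω : ∀ i k, -T.Kb ≤ k → k ≤ T.Ka → IntervalD.mem ((ω k)⁻¹) (IntervalD.aget ci.ωinvB (T.idx i k))) :
    ∀ z, T.InBoxW (T.vecF (IntervalD.loR ci.H2)) (T.vecF (IntervalD.hiR ci.H2)) z →
      ∀ i k, -T.Kb ≤ k → k ≤ T.Ka → ∀ i' k', -T.Kb ≤ k' → k' ≤ T.Ka →
        (imget (T.coreStep ci).M (T.idx i' k') (T.idx i k)).lo.toReal ≤
            (∑ m ∈ Finset.range (ci.pV + 1), varJet (T.toCertData φ).Qb z (basisSt i k) m i' k' * ci.h.toReal ^ m) -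
              T.vecF (vre (T.coreStep ci).JU) i' k' * (ω k)⁻¹ * ci.h.toReal ^ (ci.pV + 1) ∧
          (∑ m ∈ Finset.range (ci.pV + 1), varJet (T.toCertData φ).Qb z (basisSt i k) m i' k' * ci.h.toReal ^ m) +
              T.vecF (vre (T.coreStep ci).JU) i' k' * (ω k)⁻¹ * ci.h.toReal ^ (ci.pV + 1) ≤
            (imget (T.coreStep ci).M (T.idx i' k') (T.idx i k)).hi.toReal := by
  intro z hz i k hk1 hk2 i' k' hk1' hk2'
  have hzc := T.mem_of_inBoxW_loR hz
  have hS : ∀ i' k', -T.Kb ≤ k' → k' ≤ T.Ka → IntervalD.mem (T.vecF (vre (T.coreStep ci).JU) i' k' * ci.h.toReal ^ (ci.pV + 1))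
      (IntervalD.aget (ci.S T) (T.idx i' k')) := by
    intro i' k' h1 h2
    have hc' : T.idx i' k' < T.n := T.idx_lt_n i' ⟨h1, h2⟩
    rw [T.vecF_vre _ i' ⟨h1, h2⟩, CoreIn.coreStep_JU]
    unfold CoreIn.S; rw [IntervalD.aget_ofFn _ hc']
    exact IntervalD.mem_mulR ci.prec (IntervalD.mem_ofDyad _) (IntervalD.mem_powR ci.prec (IntervalD.mem_ofDyad ci.h) _)
  rw [CoreIn.coreStep_M]
  exact T.stepMatrixMF_spec hco hcB ci.prec ci.pV hH2 hzc (IntervalD.mem_ofDyad ci.h) hS hω i hk1 hk2 i' hk1' hk2'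

end CertTables

end Summit.NavierStokesRegularity.NavierStokesRegularity.Theorems.TaylorModelCert
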